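import Summits.Ventures.AbcSig.Conjectures.LevelRaising128

/-!
# Venture AbcSig — CONJECTURE `CONJ_LR32_L1` (level-raising ghosts at the levels `2⁵·ℓ`, source `32a`), TYPED per STANDING RULE (5)

HONEST FRAMING. This file states a CONJECTURE of the computation cell `pub-abcsig` about the OUTPUT OF THE MODULAR METHOD
(which newforms of level `2⁵ℓ` survive the [BS04, Lemma 4.2] trace sieve modulo `n`), as a Lean `Prop` with its evidence
ledger in this docstring. It is NOT a theorem, nothing is proved about it here, and it makes no claim on ABC or any summit.
It is filed because the coordinator's STANDING RULE (5) (2026-08-22T21:27:43Z) triggered: the conjecture survived at least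
THREE pre-registered instance predictions over TWO independent out-of-sample landings (lead RULE-5 TRIGGER CONJ-LR32,
HOME/INBOX 2026-08-23T11:52:12Z / 11:53:19Z).

STATEMENT (HOME/lead/CONJ-LEAN-SPEC.md, sha16 `d64744ef09901c26` at trigger, §CONJ_LR32_L1 WITH AMENDMENT A2-LR32; sketch
HOME/lead/spec/ConjSketch.lean `5d44b17f10b6ab51`, l.56–58, typed verbatim). Let `32a : y² = x³ − x` (conductor 32, CM by
`ℤ[i]`; the Frey–Hellegouarch class of the pseudo-solution `1 + 8 = 3²`) with traces `a32 ℓ` (`= 0` for `ℓ ≡ 3 (mod 4)`,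
`= ±2a` for `ℓ = a² + b²`, `a` odd). For primes `ℓ ≥ 3` and `n ≥ 11`, `n ≠ ℓ`, satisfying Ribet's level-raising condition
`n ∣ (ℓ + 1)² − a32(ℓ)²` (`LevelRaise a32 ℓ n`), SOME newform `f` of level `2⁵·ℓ` is congruent modulo a prime above `n` to
`32a` at every odd prime `q ∤ 2⁵ℓ` (`CongruentTo M f n a32`) AND passes the coarse trace sieve (`M.ArisesMod f n bs04Allowed`,
[BS04, Lemma 4.2]) — a "ghost" that no trace sieve can remove. No twist index is needed here (AMENDMENT A2-LR32 (1)):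
`32a ⊗ χ₋₄ ≅ 32a`, the `χ₈` / `χ₋₈` twists have level 64, and every ghost of record is congruent to `a32` itself.
Existence direction in print: [Rib90b, Thm 1] (K. Ribet, *Raising the levels of modular representations*, Progr. Math. 81
(1990) 259–271) / Diamond–Taylor: the congruent newform of level `2⁵ℓ` EXISTS under the level-raising condition; that it then
passes the [BS04] coarse sets is the cell's THEORY TASK T2(ii) (HOME/STRUCTURE.md §1b). The converse clause «no orbit of level
`2⁵ℓ` is congruent to `32a` above a prime `n ≥ 11` with `¬ LevelRaise a32 ℓ n`» is the THEOREM direction (Ribet's necessary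
condition) and is recorded here only, not as a conjecture declaration (A2-LR32 (3)).

SHARPENED EMPIRICAL LAW L3 (multiplicity; engine-2 g7's P16; A2-LR32 (2)) — NOT TYPED (the cell's `NewformModel` exposes
neither newforms as Galois orbits with decidable equality nor the eigenvalue `a_ℓ(f) = ±1` at `ℓ ∥ N`): «the `f` above are
EXACTLY ONE Galois orbit per sign `ε ∈ {±1}` with `n ∣ ℓ + 1 − ε·a32(ℓ)`, that orbit having `a_ℓ(f) = ε` (and `a₂ = 0`); two
orbits, exact `χ₋₄`-twists of each other, when both signs are admissible (`ℓ` supersingular for `32a`, `n ∣ ℓ + 1`); one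
`χ₋₄`-self-twisted orbit otherwise.» In-sample 73/73 at `n ≥ 11`; out of sample 24736 = 2⁵·773 (2/2, big-orbit mode),
14176 = 2⁵·443 (the pair) and 12832 = 2⁵·401 (the singleton).

EVIDENCE LEDGER (A2-LR32 (4)). HOME/STRUCTURE.md §6 row CONJ-LR32 and §8 scores (v2.16, 2026-08-23T11:53Z; in-sample: the
120 signed a ∈ {0, 3} row files, L1 47/47). First out-of-sample landing 24736 = 2⁵·773 (HOME/lead/PREDICTIONS-LR32-24736-lead.md,
sha16 `938b4e810d7e676f`): P5 / P6 / P7 HIT (2026-08-23T04:59Z), P13 + P15(b) HIT by two implementations (07:34Z). Second,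
independent landing kit j190834 (engine-1 msym 0.6.0-dev8; 14176 = 2⁵·443, 12832 = 2⁵·401; HOME/lead/PREDICTIONS-LR32-second-landing-lead.md,
sha16 `32bc10bad7c7a41e` at trigger, registered 09:14:19Z before the job was submitted): 14176 — P16(a)(b)(c), P18, P19, P20,
P21(L1), P21(L2″) 8/8 HIT (the supersingular PAIR 14176.11/.12, degree 52, `U₄₄₃ = ∓1`, exact `χ₋₄`-twists; T6 v3 CM-old piece
of dimension 4 to the Sturm bound 3552); 12832 — P16(a)(c), P17 (pseudo-solution pair `E₄₀₁ ⊗ {1, χ₋₄}`), P18′, P19, P20,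
P21(L1), P21(L2″), P21″ HIT (the ordinary SINGLETON 12832.12, degree 58, self-twisted); scored by engine-2 g7
(HOME/engine/engine-2/results/LR32-g7/landing/, score_lr32_landing.py + presieve), confirmed by referee ref-g33's exact ring-map
decision (HOME/referee/lr32-second-g33/) and the lead's screen. MISSES named: NEGATIVE-2 (HOME/STRUCTURE.md §8: the STRICT
completeness clause L2 'the coarse sieve alone has no survivor at n ≥ 17 outside R₃₂(ℓ)' is REFUTED in-sample once, (313; 23) on
10016.1 — L2 is not part of this declaration; the completeness clause `CONJ_LR32_L2` is deferred to a filing with the concrete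
Kraus-discharge interface) and NEGATIVE-6 (P18-as-registered at 12832 — a pre-announced registration artefact, annotation A1, not
substantive). 0 substantive MISS over two landings / three levels.

WHAT THE TYPED DECLARATION CARRIES (referee ref-g35 read, HOME/referee/lr32-l1-g35/REF-READ-CONJ_LR32_L1-g35.md 732e25b7dcf5403a;
lead R1, HOME/INBOX 2026-08-23T13:23:54Z). As typed, `CONJ_LR32_L1` is the EXISTENCE clause — in substance [Rib90b, Thm 1] / [DT94,
Thm A] in this model (with N(ρ̄_{32a,n}) = 32, lit/LEVELRAISING-PIN.md §D(3)): the conjunct `M.ArisesMod f n bs04Allowed` is implied by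
`CongruentTo M f n a32` with the same `ψ`, because `a_q(32a)` is even (full rational 2-torsion) with `a_q² ≤ 4q` (Hasse), so
`a32 q ∈ bs04Allowed q` at every odd prime `q` — see `CONJ_LR32_L1_of_exists` below, which proves exactly this reduction with the
arithmetic fact `∀ odd primes q, a32 q ∈ bs04Allowed q` isolated as a hypothesis (Hasse's bound is not in Mathlib; the fact is checked
here by `decide` for the odd primes `q < 60` only). The empirical content of CONJ-LR32 (completeness L2″, multiplicities L3) is the
docstring text above, untyped; the docstring's 'coarse sets = THEORY TASK T2(ii)' concerns the fine [BS04, Prop. 4.3] sieve, not this decl.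

The arithmetic layer (`apCubic`, `LevelRaise`, imported from `Conjectures/LevelRaising128.lean`; `a32` here) is model-free and
computable — the instance facts quoted above are checked below by `decide` in the kernel; the model layer (`CongruentTo`, the
conjecture) is phrased over the cell's abstract `NewformModel` (`Recipes/BS04.lean`) and, like every row of the cell, is MEANINGFUL
ONLY FOR THE INTENDED MODEL (newforms of weight 2, trivial character, their Hecke eigenvalues).
-/

namespace Summit.Ventures.AbcSig.Conjectures

open Summit.Ventures.AbcSig

/-! ## Arithmetic layer (model-free, computable) -/

/-- `a_ℓ(32a)`, `32a : y² = x³ − x` (conductor 32, CM by `ℤ[i]`; the Frey–Hellegouarch class of the pseudo-solution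
`1 + 8 = 3²`), for an odd prime `ℓ` (the residue `ℓ − 1` encodes the coefficient `−1`): naive point count `apCubic ℓ 0 (ℓ − 1) 0`. -/
def a32 (ℓ : ℕ) : ℤ := apCubic ℓ 0 (ℓ - 1) 0

/-- Sanity values of the engine-2 g4 table / HOME/lead/PREDICTIONS-LR32-24736-lead.md: `a₅(32a) = −2`, `a₁₃(32a) = 6`. -/
example : a32 5 = -2 ∧ a32 13 = 6 := by decide +kernel

/-- The second-landing instances (kit j190834): `ℓ = 443 ≡ 3 (mod 4)` is supersingular for `32a` (`a₄₄₃ = 0`) and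
`37 ∣ 444²`; `ℓ = 401 = 1² + 20²` has `a₄₀₁ = 2` and `101 ∣ 402² − 2² = 400·404`. Kernel-checked by `decide`. -/
example : LevelRaise a32 443 37 ∧ LevelRaise a32 401 101 := by decide +kernel

/-- The first-landing instance (ℓ = 773, level 24736): `a₇₇₃(32a) = −34` (`773 = 17² + 22²`), and
`(774 − 34)(774 + 34) = 740·808` is divisible by `37` and by `101` (`R₃₂(773) = {37, 101}`). -/
example : LevelRaise a32 773 37 ∧ LevelRaise a32 773 101 := by decide +kernel

/-- The NEGATIVE-2 instance is NOT a level-raising instance: `a₃₁₃(32a) = 26`, `(314 − 26)(314 + 26) = 288·340` is prime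
to `23` — the survivor (313; 23) on 10016.1 refutes only the strict completeness clause L2, not L1. -/
example : ¬ LevelRaise a32 313 23 := by decide +kernel

/-! ## Model-language layer (over the cell's abstract `NewformModel`; MEANINGFUL ONLY FOR THE INTENDED MODEL) -/

/-- **CONJECTURE `CONJ_LR32_L1` (level-raising ghosts at `2⁵ℓ`, source `32a`; lead g5 transposition of engine-2's law,
AMENDMENT A2-LR32) — NOT A THEOREM.** For primes `ℓ ≥ 3` and `n ≥ 11` with `n ≠ ℓ` and `n ∣ (ℓ + 1)² − a_ℓ(32a)²`, some
newform `f` of level `2⁵·ℓ` is congruent modulo a prime above `n` to the eigenvalue system of `32a` at all odd primes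
`q ∤ 2⁵ℓ`, and passes the coarse [BS04, Lemma 4.2] trace sieve modulo `n` (`M.ArisesMod f n bs04Allowed`). Evidence and
literature: module docstring (≥ 3 pre-registered instance predictions HIT over two independent landings, 0 substantive MISS;
existence half = [Rib90b, Thm 1]; multiplicity sharpening L3 recorded there, untyped). Typed per STANDING RULE (5); no proof
obligation is claimed or attempted. -/
@[conjecture] def CONJ_LR32_L1 (M : NewformModel) : Prop :=
  ∀ ℓ n : ℕ, ℓ.Prime → 3 ≤ ℓ → n.Prime → 11 ≤ n → n ≠ ℓ → LevelRaise a32 ℓ n →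
    ∃ f : M.Form (2 ^ 5 * ℓ), CongruentTo M f n a32 ∧ M.ArisesMod f n bs04Allowed

/-- The traces of `32a` at the odd primes `q < 60` lie in the [BS04, Lemma 4.2] sets (even with `a_q² ≤ 4q`) — kernel check of the
instances of the arithmetic hypothesis of `CONJ_LR32_L1_of_exists` (the general fact is Hasse's bound + the rational 2-torsion of `32a`). -/
example : (([3, 5, 7, 11, 13, 17, 19, 23, 29, 31, 37, 41, 43, 47, 53, 59] : List ℕ).all
    fun q => (bs04Allowed q).contains (a32 q)) = true := by
  decide +kernel

/-- **Reduction of `CONJ_LR32_L1` to its existence clause** (referee ref-g35's finding, lead R2): if `a32 q ∈ bs04Allowed q` for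
every odd prime `q` (true: `a_q(32a)` is even and `|a_q| ≤ 2√q`; taken here as the hypothesis `hA`), then the pure level-raising
existence statement "for `ℓ ≥ 3`, `n ≥ 11`, `n ≠ ℓ` with Ribet's condition some newform of level `2⁵ℓ` is `CongruentTo … a32`
modulo a prime above `n`" already gives `CONJ_LR32_L1 M`: the same reduction map `ψ` witnesses `M.ArisesMod f n bs04Allowed`.
PROVED (no conjecture content); it records that the typed declaration carries no sieve content beyond existence. -/
theorem CONJ_LR32_L1_of_exists (M : NewformModel) (hA : ∀ q : ℕ, q.Prime → q ≠ 2 → a32 q ∈ bs04Allowed q)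
    (hex : ∀ ℓ n : ℕ, ℓ.Prime → 3 ≤ ℓ → n.Prime → 11 ≤ n → n ≠ ℓ → LevelRaise a32 ℓ n →
      ∃ f : M.Form (2 ^ 5 * ℓ), CongruentTo M f n a32) :
    CONJ_LR32_L1 M := by
  intro ℓ n hℓ h3 hn h11 hnℓ hLR
  obtain ⟨f, k, hk, hchar, ψ, hψ⟩ := hex ℓ n hℓ h3 hn h11 hnℓ hLR
  refine ⟨f, ⟨k, hk, hchar, ψ, hψ⟩, k, hk, hchar, ψ, ?_⟩
  intro q hq hq2 _ hqN
  exact ⟨a32 q, hA q hq hq2, hψ q hq hq2 hqN⟩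

end Summit.Ventures.AbcSig.Conjectures
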